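import Summits.QuantumFields.YangMills.Theorems.BalabanUVNodesN15DefectKernel
import Literature.MathematicalPhysics.QuantumFieldTheory.King1986.MinimizerTwoSpacing
import HarnessLib

/-!
# Route «BalabanUVNodes» (K4 «SpineRates»), node N15 = NE2, THE -a ∕ -b INTERFACE OF THE BACKGROUND LAYER, part 4: THE ADJOINT FACTOR
# (fine lattice → unit lattice, pull-back on SOURCES): Riemann-weighted transposes, the exact fibre count of King's pairing, `Q_kG_k` as inhabitant

Cell `pub-ymgap`, seat `pub-ymgap-dag-n15-a` (KNIT-BY-NAME, generation g2; HUMAN RULING D-0062; chair R424 venue; `bears_on: R4∕N15`).  Filed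
`--supports stmt-QuantumFields-19351` until the node stub `S_N15` of route «BalabanUVNodes» is an item.  THEOREMS ONLY; imports BY NAME, nothing
in the tree modified: part 1 `BalabanUVNodesN15DefectKernel` (this seat: `idef_single_apply`, `map_pull_single`, `hasMaj_ofBlocks_of_entry_le`,
`fibre`∕`mem_fibre` of `T4EtaRateCoeffDefect`), `King1986.MinimizerTwoSpacing` (seat n18-b: `king_prop38_torus`), `King1986.EffectiveLaplacianSymbol`
(`minimiser`), `King1986.MinimizerAliasModes` (`prop38RateConst`, `prop38PosConst`, `lemma43Const`), `King1986.EffectiveLaplacianRate` (`aK`).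

WHY.  In the single-scale piece of the `U ≡ 1` propagator, [King1986] (4.42) p. 675 *«G^{η′}_{(j)}(x′, y′) = a²_{j+n}(L^jη)^{−4} Σ_{z,w∈L^jηZ^d}
(L^jη)^{2d}G^{η′}_{j+n}Q*_{j+n}(x′, z) · C^{(j+n),L^jη}(z, w)Q_{j+n}G^{η′}_{j+n}(w, y′)»*, the RIGHT factor `Q_kG_k` maps fine-lattice functions to
unit-lattice functions; its kernel is the transpose of the minimiser's `a_kG_kQ^*_k(x, b)` and the Riemann weights `(L^jη)^{2d}` ∕ `η^d` of the
fine sums ride with it.  Across two spacings its η-defect is taken with the pull-back on SOURCES and the identity on (unit-lattice) observations: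
`𝔇(K′,K)(δ_x)(b) = Σ_{x′ ∈ B^n(x)} K′(δ_{x′})(b) − K(δ_x)(b)` (part 1's exact entry formula) — a BLOCK SUM of `#B^n(x) = L^{nd}` fine entries
against one coarse entry, which balances exactly when the weights satisfy `η′^d·L^{nd} = η^d`.  King (p. 675): *«Clearly we can replace
a_{j+n}G^{η′}_{j+n}Q*_{j+n}(x′z) by a_jG^η_jQ*_j(x, z) … and bound the error in the same way.»*  THIS FILE is that «same way» for the adjoint
factor in binder (a)'s block-majorant format, plus the one combinatorial fact it needs (the fibre of King's pairing has exactly `L^{nd}` points).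

CONTENTS.
* §1 `idef_pull_id_single_apply` — the exact entry for (pull on sources, identity on observations): `Σ_{x′∈π⁻¹x} K′(δ_{x′})(b) − K(δ_x)(b)`.
* §2 RIEMANN-WEIGHTED TRANSPOSES: if `K(δ_x)(b) = w·H(δ_b)(x)` and `K′(δ_{x′})(b) = w′·H′(δ_b)(x′)` (`w′ ≥ 0`) with the BALANCE `w′·#π⁻¹x = w`, then
  `𝔇(K′,K)(δ_x)(b) = w′·Σ_{x′∈π⁻¹x} (H′(δ_b)(x′) − H(δ_b)(πx′))` (`idef_transpose_entry_eq`) and a paired-point bound `|H′(δ_b)(x′) − H(δ_b)(πx′)| ≤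
  κ(blk_Ω b, blk x)` gives `|𝔇(K′,K)(δ_x)(b)| ≤ w·κ` (`abs_idef_transpose_entry_le`), hence the block majorant `n₀·w·κ` between the sharp cube norms
  of the fine source lattice (block count `n₀`; for the `η`-lattice inside unit cubes `n₀·w = L^{kd}·η^d = 1`) and of the unit lattice
  (`hasMaj_idef_transpose_of_pairedRate`).
* §3 THE FIBRE OF KING'S PAIRING `x_μ = ⌊x′_μ∕L^n⌋` (`Π ℤ∕(L^nL^kM_μ) → Π ℤ∕(L^kM_μ)`, any map with that property) is in bijection with the digit box
  `[0, L^n)^d` (`kingFibreEquiv`-free statement: `card_fibre_kingProj : #π⁻¹x = (L^n)^d`), so the balance holds with `w′ = w∕L^{nd}`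
  (`king_weight_balance`).
* §4 **`hasMaj_idef_kingMinimiserAdjoint`** ⇐ `king_prop38_torus`: for King's ACTUAL `A = 0` minimisers (binders `hH`, `hH′` as in part 2) and their
  Riemann-weighted transposes `K = w·ℋ_kᵀ`, `K′ = (w∕L^{nd})·ℋ_{k+n}ᵀ` (binders `hK`, `hK′`), `L` odd `≥ 3`, `k, n ≥ 1`, `0 ≤ γ ≤ 1`, `w ≥ 0`:
  `𝔇(K′,K)` through (pull, id) has the CONSTANT block majorant `n₀·w·(C₁+C₂)·L^{−γk}` — uniformly in the volume, the mass and `n`.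

HONEST FRAMING ∕ LIMITS.  MECHANISM (§1–§3) + King's scalar `A = 0` theorem re-packaged (§4); no exponential factor (King's Theorem 3.3 decay
would enter as in part 2's `…_of_decay`); the weights `w`, `w′` are data (the Riemann normalisation is the consumer's reading); NOT Bałaban's
covariant `Q_k(U)G_k(U)`; NE2⁺ NOT PRINTED ∕ not proved; count-neutral (typed 28∕28 · discharged unchanged); NOT a discharge of N15; one finite T⁴ at
fixed ε — NOT infinite volume, NOT OS on ℝ⁴, NOT a mass gap, NOT Clay.
-/

noncomputable section

namespace Summit.QuantumFields.YangMills.BalabanUVNodes.N15.DefectKernel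

open Literature.MathematicalPhysics.QuantumFieldTheory.Balaban1983to89
open Literature.MathematicalPhysics.QuantumFieldTheory.Balaban1983to89.B11SectG (BlockNorm HasMaj)
open Literature.MathematicalPhysics.QuantumFieldTheory.Balaban1983to89.T4EtaRateDefect (idef)
open Literature.MathematicalPhysics.QuantumFieldTheory.Balaban1983to89.T4EtaRateCoeffDefect (pull pull_apply fibre
  mem_fibre)

/-! ## §1 The exact entry for the pull-back on sources and the identity on observations -/

section Entry

variable {X X' Y : Type} [Fintype X'] [DecidableEq X] [DecidableEq X']

/-- `𝔇(K′,K)(δ_x)(b) = Σ_{x′ ∈ π⁻¹x} K′(δ_{x′})(b) − K(δ_x)(b)` — the block-summed fine entries against one coarse entry, for operators INTO a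
common lattice `Y` (identity transport on observations). [folklore] -/
theorem idef_pull_id_single_apply (π : X' → X) (K' : (X' → ℝ) →ₗ[ℝ] (Y → ℝ)) (K : (X → ℝ) →ₗ[ℝ] (Y → ℝ)) (x : X) (b : Y) :
    idef (pull π) LinearMap.id K' K (Pi.single x 1) b = (∑ x' ∈ fibre π x, K' (Pi.single x' 1) b) - K (Pi.single x 1) b := by
  rw [idef_single_apply, map_pull_single, Finset.sum_apply, LinearMap.id_apply]

end Entry

/-! ## §2 Riemann-weighted transposes: the balance `w′·#π⁻¹x = w` and the paired-point bound -/

section Transpose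

variable {X X' Y : Type} [Fintype X'] [DecidableEq X] [DecidableEq X'] [DecidableEq Y]

/-- EXACT: for Riemann-weighted transposes `K(δ_x)(b) = w·H(δ_b)(x)`, `K′(δ_{x′})(b) = w′·H′(δ_b)(x′)` with the balance `w′·#π⁻¹x = w`,
`𝔇(K′,K)(δ_x)(b) = w′·Σ_{x′∈π⁻¹x} (H′(δ_b)(x′) − H(δ_b)(πx′))` — every fine point of the block is compared with ITS coarse point. [folklore] -/
theorem idef_transpose_entry_eq (π : X' → X) {K' : (X' → ℝ) →ₗ[ℝ] (Y → ℝ)} {K : (X → ℝ) →ₗ[ℝ] (Y → ℝ)}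
    {H' : (Y → ℝ) →ₗ[ℝ] (X' → ℝ)} {H : (Y → ℝ) →ₗ[ℝ] (X → ℝ)} {w w' : ℝ}
    (hK : ∀ x b, K (Pi.single x 1) b = w * H (Pi.single b 1) x)
    (hK' : ∀ x' b, K' (Pi.single x' 1) b = w' * H' (Pi.single b 1) x')
    (hw : ∀ x, w' * ((fibre π x).card : ℝ) = w) (x : X) (b : Y) :
    idef (pull π) LinearMap.id K' K (Pi.single x 1) b =
      w' * ∑ x' ∈ fibre π x, (H' (Pi.single b 1) x' - H (Pi.single b 1) (π x')) := by
  have h1 : ∑ x' ∈ fibre π x, K' (Pi.single x' 1) b = ∑ x' ∈ fibre π x, w' * H' (Pi.single b 1) x' :=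
    Finset.sum_congr rfl fun x' _ => hK' x' b
  have h2 : ∑ x' ∈ fibre π x, w' * H (Pi.single b 1) (π x') = ∑ _x' ∈ fibre π x, w' * H (Pi.single b 1) x :=
    Finset.sum_congr rfl fun x' hx' => by rw [(mem_fibre π x x').1 hx']
  rw [idef_pull_id_single_apply, hK, ← hw x, Finset.mul_sum]
  simp_rw [mul_sub]
  rw [Finset.sum_sub_distrib, h1, h2, Finset.sum_const, nsmul_eq_mul]
  ring

/-- THE PAIRED-POINT BOUND FOR THE TRANSPOSE: `|H′(δ_b)(x′) − H(δ_b)(πx′)| ≤ κ(b, πx′)` for all fine `x′` gives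
`|𝔇(K′,K)(δ_x)(b)| ≤ w·κ(b, x)` under the balance (`w′ ≥ 0`). [cite: King1986, p.675 «we can replace a_{j+n}G^{η′}_{j+n}Q*_{j+n} by a_jG^η_jQ*_j … and bound the error in the same way» (mechanism)] -/
theorem abs_idef_transpose_entry_le (π : X' → X) {K' : (X' → ℝ) →ₗ[ℝ] (Y → ℝ)} {K : (X → ℝ) →ₗ[ℝ] (Y → ℝ)}
    {H' : (Y → ℝ) →ₗ[ℝ] (X' → ℝ)} {H : (Y → ℝ) →ₗ[ℝ] (X → ℝ)} {w w' : ℝ} (hw' : 0 ≤ w')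
    (hK : ∀ x b, K (Pi.single x 1) b = w * H (Pi.single b 1) x)
    (hK' : ∀ x' b, K' (Pi.single x' 1) b = w' * H' (Pi.single b 1) x')
    (hw : ∀ x, w' * ((fibre π x).card : ℝ) = w) {κ : Y → X → ℝ}
    (hR : ∀ b x', |H' (Pi.single b 1) x' - H (Pi.single b 1) (π x')| ≤ κ b (π x')) (x : X) (b : Y) :
    |idef (pull π) LinearMap.id K' K (Pi.single x 1) b| ≤ w * κ b x := by
  rw [idef_transpose_entry_eq π hK hK' hw, abs_mul, abs_of_nonneg hw', ← hw x, mul_assoc]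
  refine mul_le_mul_of_nonneg_left ?_ hw'
  calc |∑ x' ∈ fibre π x, (H' (Pi.single b 1) x' - H (Pi.single b 1) (π x'))|
      ≤ ∑ x' ∈ fibre π x, |H' (Pi.single b 1) x' - H (Pi.single b 1) (π x')| := Finset.abs_sum_le_sum_abs _ _
    _ ≤ ∑ x' ∈ fibre π x, κ b x := Finset.sum_le_sum fun x' hx' => by
        have h := hR b x'
        rw [(mem_fibre π x x').1 hx'] at h ⊢
        exact h
    _ = ((fibre π x).card : ℝ) * κ b x := by rw [Finset.sum_const, nsmul_eq_mul]

variable [Fintype X] [Fintype Y] {g : B6.Geometry} [DecidableEq g.Site]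

/-- **THE ADJOINT FACTOR IN BINDER (a)'s FORMAT.**  Riemann-weighted transposes `K = w·Hᵀ`, `K′ = w′·H′ᵀ` of operators `H : (Y → ℝ) → (X → ℝ)`,
`H′ : (Y → ℝ) → (X′ → ℝ)` from a common (unit) lattice `Y`, balanced (`w′·#π⁻¹x = w`, `w′ ≥ 0`), with a paired-point bound in block form
`|H′(δ_b)(x′) − H(δ_b)(πx′)| ≤ κ(blk_Y b, blk_X(πx′))` (`κ ≥ 0`) and at most `n₀` points of `X` per cube: `𝔇(K′,K)` through (pull on sources,
identity on observations) has the block majorant `n₀·w·κ(y,y′)` from the sharp cube norm of `X` to that of `Y`. [cite: King1986, p.675 (mechanism)] -/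
theorem hasMaj_idef_transpose_of_pairedRate (blkX : X → g.Site) (blkY : Y → g.Site) {n₀ : ℕ}
    (hn₀ : ∀ y', (fibre blkX y').card ≤ n₀) (π : X' → X) {K' : (X' → ℝ) →ₗ[ℝ] (Y → ℝ)} {K : (X → ℝ) →ₗ[ℝ] (Y → ℝ)}
    {H' : (Y → ℝ) →ₗ[ℝ] (X' → ℝ)} {H : (Y → ℝ) →ₗ[ℝ] (X → ℝ)} {w w' : ℝ} (hw0 : 0 ≤ w) (hw' : 0 ≤ w')
    (hK : ∀ x b, K (Pi.single x 1) b = w * H (Pi.single b 1) x)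
    (hK' : ∀ x' b, K' (Pi.single x' 1) b = w' * H' (Pi.single b 1) x')
    (hw : ∀ x, w' * ((fibre π x).card : ℝ) = w) {κ : g.Site → g.Site → ℝ} (hκ : ∀ y y', 0 ≤ κ y y')
    (hR : ∀ b x', |H' (Pi.single b 1) x' - H (Pi.single b 1) (π x')| ≤ κ (blkY b) (blkX (π x'))) :
    HasMaj (BlockNorm.ofBlocks g blkX) (BlockNorm.ofBlocks g blkY) (idef (pull π) LinearMap.id K' K)
      (fun y y' => n₀ * (w * κ y y')) :=
  hasMaj_ofBlocks_of_entry_le blkX blkY (fun y y' => mul_nonneg hw0 (hκ y y')) hn₀ fun b x =>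
    abs_idef_transpose_entry_le π hw' hK hK' hw (κ := fun b x => κ (blkY b) (blkX x)) hR x b

end Transpose

/-! ## §3 The fibre of King's pairing `x_μ = ⌊x′_μ∕L^n⌋` has exactly `L^{nd}` points -/

section Fibre

open Literature.MathematicalPhysics.QuantumFieldTheory.Balaban1983to89.B5Prop11Plancherel (Tor fine)

variable {d : ℕ} (L : ℕ) [NeZero L] (k n : ℕ) (M : Fin d → ℕ) [hM : ∀ μ, NeZero (M μ)]

omit hM in
/-- The digits of a fine point inside its block: `x′_μ mod L^n`. [folklore] -/
theorem digit_lt (x' : Tor (fine (L ^ n * L ^ k) M)) (μ : Fin d) : (x' μ).val % L ^ n < L ^ n :=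
  Nat.mod_lt _ (pos_of_ne_zero (NeZero.ne (L ^ n)))

/-- The point of the block over `x` with digits `j`: `L^n·x_μ + j_μ` (no wrap-around: `L^n·x_μ + j_μ < L^nL^kM_μ`). [folklore] -/
theorem val_blockPoint (x : Tor (fine (L ^ k) M)) (j : Fin d → Fin (L ^ n)) (μ : Fin d) :
    (((L ^ n * (x μ).val + (j μ : ℕ) : ℕ) : ZMod (fine (L ^ n * L ^ k) M μ))).val = L ^ n * (x μ).val + (j μ : ℕ) := by
  rw [ZMod.val_natCast, Nat.mod_eq_of_lt]
  have hx : (x μ).val < L ^ k * M μ := ZMod.val_lt (x μ)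
  have hj : (j μ : ℕ) < L ^ n := (j μ).isLt
  show L ^ n * (x μ).val + (j μ : ℕ) < L ^ n * L ^ k * M μ
  calc L ^ n * (x μ).val + (j μ : ℕ) < L ^ n * (x μ).val + L ^ n := by omega
    _ = L ^ n * ((x μ).val + 1) := by ring
    _ ≤ L ^ n * (L ^ k * M μ) := Nat.mul_le_mul_left _ hx
    _ = L ^ n * L ^ k * M μ := by ring

/-- **`#π⁻¹x = L^{nd}`** for every map `π : Π ℤ∕(L^nL^kM_μ) → Π ℤ∕(L^kM_μ)` with King's property `(πx′)_μ = ⌊x′_μ∕L^n⌋`: the fibre is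
parametrised by the digit box `[0, L^n)^d`. [cite: King1986, p.664 (pairing convention «x′ ∈ B^n(x)»)] -/
theorem card_fibre_kingProj (pr : Tor (fine (L ^ n * L ^ k) M) → Tor (fine (L ^ k) M))
    (hpr : ∀ x' μ, (pr x' μ).val = (x' μ).val / L ^ n) (x : Tor (fine (L ^ k) M)) :
    (fibre pr x).card = (L ^ n) ^ d := by
  classical
  have hLn : 0 < L ^ n := pos_of_ne_zero (NeZero.ne (L ^ n))
  -- the digit map and the block-point map
  let toDig : Tor (fine (L ^ n * L ^ k) M) → (Fin d → Fin (L ^ n)) :=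
    fun x' μ => ⟨(x' μ).val % L ^ n, digit_lt L k n M x' μ⟩
  let ofDig : (Fin d → Fin (L ^ n)) → Tor (fine (L ^ n * L ^ k) M) :=
    fun j μ => ((L ^ n * (x μ).val + (j μ : ℕ) : ℕ) : ZMod (fine (L ^ n * L ^ k) M μ))
  -- `ofDig j` lies over `x`
  have hover : ∀ j, pr (ofDig j) = x := by
    intro j
    funext μ
    apply ZMod.val_injective
    rw [hpr, val_blockPoint]
    have hj : (j μ : ℕ) < L ^ n := (j μ).isLt
    rw [show L ^ n * (x μ).val + (j μ : ℕ) = (j μ : ℕ) + L ^ n * (x μ).val by ring, Nat.add_mul_div_left _ _ hLn,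
      Nat.div_eq_of_lt hj, zero_add]
  -- the fibre is the image of the digit box
  have himage : fibre pr x = Finset.univ.image ofDig := by
    ext x'
    rw [mem_fibre, Finset.mem_image]
    constructor
    · intro hx'
      refine ⟨toDig x', Finset.mem_univ _, ?_⟩
      funext μ
      apply ZMod.val_injective
      rw [val_blockPoint]
      show L ^ n * (x μ).val + (x' μ).val % L ^ n = (x' μ).val
      rw [← hx', hpr]
      exact Nat.div_add_mod _ _
    · rintro ⟨j, _, rfl⟩
      exact hover j
  have hinj : Function.Injective ofDig := by
    intro j j' h
    funext μ
    apply Fin.ext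
    have hv := congrArg (fun y : Tor (fine (L ^ n * L ^ k) M) => (y μ).val) h
    simp only [ofDig, val_blockPoint] at hv
    omega
  rw [himage, Finset.card_image_of_injective _ hinj, Finset.card_univ, Fintype.card_pi, Fintype.card_fin,
    Finset.prod_const, Finset.card_univ, Fintype.card_fin]

/-- THE BALANCE for King's pairing: with `w′ = w∕L^{nd}` (the Riemann weights `η′^d = η^d∕L^{nd}`), `w′·#π⁻¹x = w`. [folklore] -/
theorem king_weight_balance (pr : Tor (fine (L ^ n * L ^ k) M) → Tor (fine (L ^ k) M))
    (hpr : ∀ x' μ, (pr x' μ).val = (x' μ).val / L ^ n) (w : ℝ) (x : Tor (fine (L ^ k) M)) :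
    w / ((L : ℝ) ^ n) ^ d * ((fibre pr x).card : ℝ) = w := by
  rw [card_fibre_kingProj L k n M pr hpr x]
  have hL : ((L : ℝ) ^ n) ^ d ≠ 0 := pow_ne_zero _ (pow_ne_zero _ (Nat.cast_ne_zero.mpr (NeZero.ne L)))
  push_cast
  field_simp

end Fibre

/-! ## §4 King's adjoint minimiser `Q_kG_k` (Riemann-weighted transpose of `a_kG_kQ_k^*`) in binder (a)'s format -/

section King

open Literature.MathematicalPhysics.QuantumFieldTheory.Balaban1983to89.B5Prop11Plancherel (Tor fine)
open Literature.MathematicalPhysics.QuantumFieldTheory.King1986 (aK prop38RateConst prop38PosConst lemma43Const)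
open Literature.MathematicalPhysics.QuantumFieldTheory.King1986.Torus (minimiser king_prop38_torus)

variable {d : ℕ}

/-- **KING'S ADJOINT MINIMISER IN BINDER (a)'s FORMAT.**  `ℋ_k = a_kG^η_kQ^*_k` on `Π ℤ∕(L^kM_μ)`, `ℋ_{k+n}` on `Π ℤ∕(L^nL^kM_μ)` (King's ACTUAL
`A = 0` minimisers, binders `hH`, `hH′`), their Riemann-weighted transposes `K(δ_x)(b) = w·ℋ_k(x,b)`, `K′(δ_{x′})(b) = (w∕L^{nd})·ℋ_{k+n}(x′,b)`
(`w ≥ 0`; binders `hK`, `hK′`), King's pairing `pr` (`x_μ = ⌊x′_μ∕L^n⌋`), `L` odd, `L ≥ 2`, `k, n ≥ 1`, `a, m² > 0`, `0 ≤ γ ≤ 1`, ANY site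
assignments (`n₀` fine points of `T_η` per cube): `𝔇(K′,K)` through (pull on sources, identity on unit-lattice observations) has the CONSTANT
block majorant `n₀·w·(C₁+C₂)·L^{−γk}`. [cite: King1986, Prop. 3.8 (3.71) p.664; p.675 «we can replace a_{j+n}G^{η′}_{j+n}Q*_{j+n} by a_jG^η_jQ*_j … in the same way»] -/
theorem hasMaj_idef_kingMinimiserAdjoint (hd : 0 < d) {L : ℕ} [NeZero L] (hLodd : Odd L) (hL : 2 ≤ L) {k n : ℕ}
    (hk : 1 ≤ k) (hn : 1 ≤ n) (M : Fin d → ℕ) [hM : ∀ μ, NeZero (M μ)] {a m2 : ℝ} (ha : 0 < a) (hm : 0 < m2)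
    {γ : ℝ} (hγ0 : 0 ≤ γ) (hγ1 : γ ≤ 1) {g : B6.Geometry} [DecidableEq g.Site]
    (blkX : Tor (fine (L ^ k) M) → g.Site) (blkY : Tor M → g.Site) {n₀ : ℕ} (hn₀ : ∀ y', (fibre blkX y').card ≤ n₀)
    (pr : Tor (fine (L ^ n * L ^ k) M) → Tor (fine (L ^ k) M)) (hpr : ∀ x' μ, (pr x' μ).val = (x' μ).val / L ^ n)
    (H : (Tor M → ℝ) →ₗ[ℝ] (Tor (fine (L ^ k) M) → ℝ))
    (hH : ∀ φ, H φ = minimiser (L ^ k) M (aK a L k) (((L ^ k : ℕ) : ℝ) ^ 2) m2 φ)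
    (H' : (Tor M → ℝ) →ₗ[ℝ] (Tor (fine (L ^ n * L ^ k) M) → ℝ))
    (hH' : ∀ φ, H' φ = minimiser (L ^ n * L ^ k) M (aK a L (k + n)) (((L ^ n * L ^ k : ℕ) : ℝ) ^ 2) m2 φ)
    {w : ℝ} (hw0 : 0 ≤ w) (K : (Tor (fine (L ^ k) M) → ℝ) →ₗ[ℝ] (Tor M → ℝ))
    (hK : ∀ x b, K (Pi.single x 1) b = w * H (Pi.single b 1) x)
    (K' : (Tor (fine (L ^ n * L ^ k) M) → ℝ) →ₗ[ℝ] (Tor M → ℝ))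
    (hK' : ∀ x' b, K' (Pi.single x' 1) b = w / ((L : ℝ) ^ n) ^ d * H' (Pi.single b 1) x') :
    HasMaj (BlockNorm.ofBlocks g blkX) (BlockNorm.ofBlocks g blkY) (idef (pull pr) LinearMap.id K' K)
      (fun _ _ => n₀ * (w * ((prop38RateConst a a (lemma43Const a L k n) ((Real.pi ^ 2 / 4) ^ d) d γ
        + prop38PosConst a ((Real.pi ^ 2 / 4) ^ d) d γ) * ((L ^ k : ℕ) : ℝ) ^ (-γ)))) := by
  have hent : ∀ (b : Tor M) (x' : Tor (fine (L ^ n * L ^ k) M)),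
      |H' (Pi.single b 1) x' - H (Pi.single b 1) (pr x')| ≤
        (prop38RateConst a a (lemma43Const a L k n) ((Real.pi ^ 2 / 4) ^ d) d γ
          + prop38PosConst a ((Real.pi ^ 2 / 4) ^ d) d γ) * ((L ^ k : ℕ) : ℝ) ^ (-γ) := by
    intro b x'
    rw [hH', hH]
    exact king_prop38_torus hd hLodd hL hk hn M ha hm hγ0 hγ1 b (pr x') x' (hpr x')
  have h0 : (0 : ℝ) ≤ (prop38RateConst a a (lemma43Const a L k n) ((Real.pi ^ 2 / 4) ^ d) d γ
      + prop38PosConst a ((Real.pi ^ 2 / 4) ^ d) d γ) * ((L ^ k : ℕ) : ℝ) ^ (-γ) :=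
    (abs_nonneg _).trans (hent 0 0)
  have hw' : 0 ≤ w / ((L : ℝ) ^ n) ^ d := div_nonneg hw0 (pow_nonneg (pow_nonneg (Nat.cast_nonneg _) _) _)
  exact hasMaj_idef_transpose_of_pairedRate blkX blkY hn₀ pr hw0 hw' hK hK' (king_weight_balance L k n M pr hpr w)
    (κ := fun _ _ => _) (fun _ _ => h0) fun b x' => hent b x'

end King

end Summit.QuantumFields.YangMills.BalabanUVNodes.N15.DefectKernel
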